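import Mathlib
import HarnessLib
import Summits.ResolutionOfSingularities.ResolutionOfSingularities.Theorems.WildQuotientsWildQuotientResolutionS1aJInf

/-!
# S1a — THE TWO HALVES (K)/(A) OF THE RULE OF RECORD `KillOrAuxRuleJInf`, its per-datum relative form, and the topology of the
# non-killable locus (STRATEGY-DESIGN v3.2 §1 (A1), §3 items 1–2)

[OURS · L1 W4.5c · lead-1 g8; plan-1 ASSIGNMENT v10.7 row 1 (a), SIG `L/w45c/W45cKillOrAux.lean` v3 9f97ecb38a7ac877 (halves verbatim),
STRATEGY-DESIGN v3.2 27fab3abd239d848] — NOT statements of the manuscript; counted 0; AI-level work, weaker than expert review. Crux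
stmt-ResolutionOfSingularities-17941 `CyclicQuotientFourfolds`, line `s1a-logminvertex` v6, stub `stub_winningStrategy` (= tree theorem modulo
`KillOrAuxRuleJInf p`, `winningStrategy_of_killOrAuxRuleJInf`). Route-independent (no `Theses` import).

* `KillHalfJInf p` **(K)** and `AuxHalfJInf p` **(A)** — plan-1ʼs halves, verbatim; `killOrAuxRuleJInf_of_halves` (trivial case split) and the
  converse on the kill side `killHalfJInf_of_killOrAuxRuleJInf` (at `jInf = ⊥` the AUX branch is impossible).
* `KillOrAuxRuleJInfOn p q G ρ g₀ P` — the SAME dichotomy for ONE datum and RELATIVE to a predicate `P` on its models (moves must stay in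
  `P`). Why: the absolute forms quantify over every datum `q : X' ⟶ X₁` and every `G`-model in every dimension, whereas the consumer
  `GModel.wins_of_killOrAuxJInf` (p601203) only ever needs the dichotomy along the models REACHED from the initial model of a datum of the
  crux (perfect field, `dim X₁ ≤ 4`, …); `killOrAuxRuleJInfOn_of_killOrAuxRuleJInf`, **`GModel.wins_of_killOrAuxRuleJInfOn`**,
  `GModel.wins_initial_of_killOrAuxRuleJInfOn`.
* (A1) the NON-KILLABLE LOCUS is CLOSED and `G`-STABLE: `KillableAt` is an open and `G`-invariant condition (`isOpen_setOf_killableAt`,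
  `killableAt_aut_base_iff`), hence `isClosed_nonKillable`, `aut_base_mem_nonKillable_iff`, finitely many irreducible components on a
  quasi-compact model; `jInf_eq_bot_iff : jInf M = ⊥ ↔ nonKillable M = ∅`, `killableAt_of_jInf_eq_bot` (the hypothesis of (K) in usable form),
  `jInf_ne_bot_iff`.
-/

set_option linter.dupNamespace false

noncomputable section

open CategoryTheory Limits AlgebraicGeometry TopologicalSpace Topology
open Literature.AlgebraicGeometry.Resolution Literature.AlgebraicGeometry.RelativeSpec
open Summit.ResolutionOfSingularities.ResolutionOfSingularities.Theorems.WildQuotientResolution.S1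
open Summit.ResolutionOfSingularities.ResolutionOfSingularities.Theorems.WildQuotientResolution.S1.NodeAtlas

namespace Summit.ResolutionOfSingularities.ResolutionOfSingularities.Theorems.WildQuotientResolution.S1

/-! ## The two halves of the rule of record -/

/-- **(K) KILL HALF of the `jInf` rule** (plan-1 SIG v3, verbatim; OURS CANDIDATE research statement, asserted nowhere): at a non-terminal model
over a Noetherian base all of whose bad points are killable (`jInf = ⊥`) there is a PRINCIPAL centre whose principal-centre charts meet every
irreducible component of the bad locus and whose moves do not increase `jInf`. Content (STRATEGY-DESIGN v3.2 §1): (K1) canonicity of the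
LP-minimal local kill, (K2) gluing of the local Rees filtrations over a `G`-stable cover, (K3) support = bad component; evidence dim 4 only.
[OURS · L1 W4.5c] -/
def KillHalfJInf (p : ℕ) : Prop :=
  ∀ ⦃X' X₁ : Scheme.{0}⦄ (q : X' ⟶ X₁) (G : Type) [Group G] [Finite G] (ρ : G →* Aut X') (g₀ : G),
    (∀ g : G, g ∈ Subgroup.zpowers g₀) →
    ∀ M : GameFrame.GModel p q G ρ g₀, M.HasNoetherianBase → ¬ M.Terminal → M.jInf = ⊥ →
      ∃ (𝒦 : ReesFiltration M.V) (d : ℕ), IsPrincipalCentre p M.act g₀ 𝒦 d ∧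
        (∀ t ∈ irreducibleComponents ↥M.badLocus, ∃ x ∈ t, (x : M.V) ∈ M.principalKillOpen 𝒦 d) ∧
        ∀ M' : GameFrame.GModel p q G ρ g₀, M.IsMoveOf M' 𝒦 d → M'.jInf ≤ M.jInf

/-- **(A) AUX HALF of the `jInf` rule** (plan-1 SIG v3, verbatim; OURS CANDIDATE research statement, asserted nowhere): at a non-terminal model
over a Noetherian base with a non-killable bad point (`jInf ≠ ⊥`) there is an AUX centre (admissible, principal-or-idle at the good points) all of
whose moves have strictly smaller `jInf`. Content (STRATEGY-DESIGN v3.2 §2): (A1) the non-killable locus is closed and `G`-stable (this file),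
(A2) the LP-relaxed weighted blow-up of its top smooth stratum lowers `jInf` (weak form), (A3) accounting; evidence dim 4 only.
[OURS · L1 W4.5c] -/
def AuxHalfJInf (p : ℕ) : Prop :=
  ∀ ⦃X' X₁ : Scheme.{0}⦄ (q : X' ⟶ X₁) (G : Type) [Group G] [Finite G] (ρ : G →* Aut X') (g₀ : G),
    (∀ g : G, g ∈ Subgroup.zpowers g₀) →
    ∀ M : GameFrame.GModel p q G ρ g₀, M.HasNoetherianBase → ¬ M.Terminal → M.jInf ≠ ⊥ →
      ∃ (𝒦 : ReesFiltration M.V) (d : ℕ), IsAuxCentre p M.act g₀ 𝒦 d (M.badLocus)ᶜ ∧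
        ∀ M' : GameFrame.GModel p q G ρ g₀, M.IsMoveOf M' 𝒦 d → M'.jInf < M.jInf

/-- **The two halves give the rule of record** (case split on `jInf M = ⊥`). [OURS · L1 W4.5c] -/
theorem killOrAuxRuleJInf_of_halves {p : ℕ} (hK : KillHalfJInf p) (hA : AuxHalfJInf p) : KillOrAuxRuleJInf p := by
  intro X' X₁ q G _ _ ρ g₀ hG M hB hT
  by_cases h : M.jInf = ⊥
  · exact Or.inl (hK q G ρ g₀ hG M hB hT h)
  · exact Or.inr (hA q G ρ g₀ hG M hB hT h)

/-- Conversely the rule of record contains the kill half: at `jInf M = ⊥` its AUX branch is impossible (`jInf Mʼ < ⊥` has no solution —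
and by the chart residue a move always exists). Stated without the move-existence input: the rule's answer at such a model IS a KILL or an
AUX all of whose moves satisfy `jInf Mʼ < ⊥`. [OURS · L1 W4.5c] -/
theorem kill_or_vacuousAux_of_killOrAuxRuleJInf {p : ℕ} (h : KillOrAuxRuleJInf p)
    ⦃X' X₁ : Scheme.{0}⦄ (q : X' ⟶ X₁) (G : Type) [Group G] [Finite G] (ρ : G →* Aut X') (g₀ : G)
    (hG : ∀ g : G, g ∈ Subgroup.zpowers g₀) (M : GameFrame.GModel p q G ρ g₀) (hB : M.HasNoetherianBase) (hT : ¬ M.Terminal)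
    (hj : M.jInf = ⊥) :
    (∃ (𝒦 : ReesFiltration M.V) (d : ℕ), IsPrincipalCentre p M.act g₀ 𝒦 d ∧
        (∀ t ∈ irreducibleComponents ↥M.badLocus, ∃ x ∈ t, (x : M.V) ∈ M.principalKillOpen 𝒦 d) ∧
        ∀ M' : GameFrame.GModel p q G ρ g₀, M.IsMoveOf M' 𝒦 d → M'.jInf ≤ M.jInf) ∨
      ∃ (𝒦 : ReesFiltration M.V) (d : ℕ), IsAuxCentre p M.act g₀ 𝒦 d (M.badLocus)ᶜ ∧
        ∀ M' : GameFrame.GModel p q G ρ g₀, ¬ M.IsMoveOf M' 𝒦 d := by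
  rcases h q G ρ g₀ hG M hB hT with hk | ⟨𝒦, d, haux, hmoves⟩
  · exact Or.inl hk
  · exact Or.inr ⟨𝒦, d, haux, fun M' hmv => absurd (hj ▸ hmoves M' hmv) not_lt_bot⟩

/-! ## The per-datum, `P`-relative form -/

/-- **The kill-or-aux dichotomy for ONE datum, RELATIVE to a predicate `P` on its models** (moves of the chosen centre must stay in `P`):
the shape actually consumed by `GModel.wins_of_killOrAuxJInf`. Intended `P`: «reachable from the initial model of a datum of the crux»
(perfect ground field of characteristic `p`, `dim X₁ ≤ 4`, …), so that the research halves (K)/(A) may be proved where the evidence lives.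
`KillOrAuxRuleJInf p` is the case `P = ⊤` for every datum (`killOrAuxRuleJInfOn_of_killOrAuxRuleJInf`). [OURS · L1 W4.5c] -/
def KillOrAuxRuleJInfOn (p : ℕ) {X' X₁ : Scheme.{0}} (q : X' ⟶ X₁) (G : Type) [Group G] (ρ : G →* Aut X') (g₀ : G)
    (P : GameFrame.GModel p q G ρ g₀ → Prop) : Prop :=
  ∀ M : GameFrame.GModel p q G ρ g₀, P M → M.HasNoetherianBase → ¬ M.Terminal →
    (∃ (𝒦 : ReesFiltration M.V) (d : ℕ), IsPrincipalCentre p M.act g₀ 𝒦 d ∧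
      (∀ t ∈ irreducibleComponents ↥M.badLocus, ∃ x ∈ t, (x : M.V) ∈ M.principalKillOpen 𝒦 d) ∧
      ∀ M' : GameFrame.GModel p q G ρ g₀, M.IsMoveOf M' 𝒦 d → P M' ∧ M'.jInf ≤ M.jInf) ∨
    (∃ (𝒦 : ReesFiltration M.V) (d : ℕ), IsAuxCentre p M.act g₀ 𝒦 d (M.badLocus)ᶜ ∧
      ∀ M' : GameFrame.GModel p q G ρ g₀, M.IsMoveOf M' 𝒦 d → P M' ∧ M'.jInf < M.jInf)

/-- The absolute rule is the relative rule with `P = ⊤`, for every cyclic datum. [OURS · L1 W4.5c] -/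
theorem killOrAuxRuleJInfOn_of_killOrAuxRuleJInf {p : ℕ} (h : KillOrAuxRuleJInf p)
    {X' X₁ : Scheme.{0}} (q : X' ⟶ X₁) (G : Type) [Group G] [Finite G] (ρ : G →* Aut X') (g₀ : G)
    (hG : ∀ g : G, g ∈ Subgroup.zpowers g₀) : KillOrAuxRuleJInfOn p q G ρ g₀ fun _ => True := by
  intro M _ hB hT
  rcases h q G ρ g₀ hG M hB hT with ⟨𝒦, d, hprin, hhit, hmoves⟩ | ⟨𝒦, d, haux, hmoves⟩
  · exact Or.inl ⟨𝒦, d, hprin, hhit, fun M' hmv => ⟨trivial, hmoves M' hmv⟩⟩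
  · exact Or.inr ⟨𝒦, d, haux, fun M' hmv => ⟨trivial, hmoves M' hmv⟩⟩

/-- The relative rule is antitone in nothing and monotone in nothing (`P` occurs on both sides); but it restricts along an invariant
conjunct: if `Q` is preserved by every move, the rule relative to `P` gives the rule relative to `P ∧ Q`. [OURS · L1 W4.5c] -/
theorem KillOrAuxRuleJInfOn.and_invariant {p : ℕ} {X' X₁ : Scheme.{0}} {q : X' ⟶ X₁} {G : Type} [Group G] {ρ : G →* Aut X'} {g₀ : G}
    {P Q : GameFrame.GModel p q G ρ g₀ → Prop} (h : KillOrAuxRuleJInfOn p q G ρ g₀ P)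
    (hQ : ∀ (M M' : GameFrame.GModel p q G ρ g₀) (𝒦 : ReesFiltration M.V) (d : ℕ), Q M → M.IsMoveOf M' 𝒦 d → Q M') :
    KillOrAuxRuleJInfOn p q G ρ g₀ fun M => P M ∧ Q M := by
  intro M hPQ hB hT
  rcases h M hPQ.1 hB hT with ⟨𝒦, d, hprin, hhit, hmoves⟩ | ⟨𝒦, d, haux, hmoves⟩
  · exact Or.inl ⟨𝒦, d, hprin, hhit, fun M' hmv => ⟨⟨(hmoves M' hmv).1, hQ M M' 𝒦 d hPQ.2 hmv⟩, (hmoves M' hmv).2⟩⟩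
  · exact Or.inr ⟨𝒦, d, haux, fun M' hmv => ⟨⟨(hmoves M' hmv).1, hQ M M' 𝒦 d hPQ.2 hmv⟩, (hmoves M' hmv).2⟩⟩

namespace GameFrame.GModel

variable {p : ℕ} {X' X₁ : Scheme.{0}} {q : X' ⟶ X₁} {G : Type} [Group G] {ρ : G →* Aut X'} {g₀ : G}

/-- **The relative rule makes every `P`-model of a datum over a field win.** [OURS · L1 W4.5c] -/
theorem wins_of_killOrAuxRuleJInfOn [Finite G] (hp : p.Prime) (hG : ∀ g : G, g ∈ Subgroup.zpowers g₀) {k : Type} [Field k]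
    (f : X₁ ⟶ Spec (.of k)) [LocallyOfFiniteType f] [QuasiCompact f] [IsFinite q] {P : GModel p q G ρ g₀ → Prop}
    (hrule : KillOrAuxRuleJInfOn p q G ρ g₀ P) (M₀ : GModel p q G ρ g₀) (hP₀ : P M₀) : Wins p q G ρ g₀ M₀ := by
  obtain ⟨n₀, hn₀⟩ := exists_nat_nu1_lt_of_datum f M₀
  refine wins_of_killOrAuxJInf hp hG P (fun M hPM hB hT => ?_) M₀ hP₀ (hasNoetherianBase_of_datum f _) hn₀
  rcases hrule M hPM hB hT with ⟨𝒦, d, hprin, hhit, hmoves⟩ | ⟨𝒦, d, haux, hmoves⟩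
  · exact Or.inl ⟨𝒦, d, hprin, hhit, fun M' hmv =>
      ⟨(hmoves M' hmv).1, hasNoetherianBase_of_datum f M', (hmoves M' hmv).2⟩⟩
  · exact Or.inr ⟨𝒦, d, haux.1, fun M' hmv =>
      ⟨(hmoves M' hmv).1, hasNoetherianBase_of_datum f M', exists_nat_nu1_lt_of_datum f M', (hmoves M' hmv).2⟩⟩

/-- **The relative rule along any `P` containing the initial model makes the initial model win.** [OURS · L1 W4.5c] -/
theorem wins_initial_of_killOrAuxRuleJInfOn (hp : p.Prime) {k : Type} [Field k] (f : X₁ ⟶ Spec (.of k))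
    [LocallyOfFiniteType f] [QuasiCompact f] [IsFinite q] [Finite G] (hG : ∀ g : G, g ∈ Subgroup.zpowers g₀)
    (hq : ∀ g : G, (ρ g).hom ≫ q = q) [IsIntegral X'] [IsLocallyNoetherian X'] (h₀ : NodeAtlas p (⟨ρ, hq⟩ : ActionOver q G) g₀)
    {P : GModel p q G ρ g₀ → Prop} (hrule : KillOrAuxRuleJInfOn p q G ρ g₀ P) (hP₀ : P (GModel.initial hq h₀)) :
    Wins p q G ρ g₀ (GModel.initial hq h₀) :=
  wins_of_killOrAuxRuleJInfOn hp hG f hrule _ hP₀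

/-! ## (A1) The non-killable locus is closed and `G`-stable -/

/-- A point of a principal-centre chart (of positive Veronese degree) is killable. -/
theorem killableAt_of_mem (M : GModel p q G ρ g₀) {𝒦 : ReesFiltration M.V} {d : ℕ} {O : M.act.StableAffineOpens}
    (hO : IsPrincipalCentreChart p M.act g₀ 𝒦 d O) (hd : 0 < d) {v : M.V} (hv : v ∈ O.1) : M.KillableAt v :=
  ⟨𝒦, d, O, hd, hv, hO⟩

/-- A point of the principal-kill open of a principal centre is killable. -/
theorem killableAt_of_mem_principalKillOpen (M : GModel p q G ρ g₀) {𝒦 : ReesFiltration M.V} {d : ℕ}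
    (h𝒦 : IsPrincipalCentre p M.act g₀ 𝒦 d) {v : M.V} (hv : v ∈ M.principalKillOpen 𝒦 d) : M.KillableAt v := by
  obtain ⟨O, hO⟩ := Set.mem_iUnion.mp hv
  obtain ⟨hO, hvO⟩ := Set.mem_iUnion.mp hO
  exact M.killableAt_of_mem hO h𝒦.1 hvO

/-- **Killability is an open condition** (the witnessing chart witnesses for all its points). [OURS · L1 W4.5c] -/
theorem isOpen_setOf_killableAt (M : GModel p q G ρ g₀) : IsOpen {v | M.KillableAt v} := by
  rw [isOpen_iff_forall_mem_open]
  rintro v ⟨𝒦, d, O, hd, hv, hO⟩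
  exact ⟨O.1, fun w hw => ⟨𝒦, d, O, hd, hw, hO⟩, O.1.isOpen, hv⟩

/-- The non-killable locus lies in the bad locus. -/
theorem nonKillable_subset_badLocus (M : GModel p q G ρ g₀) : M.nonKillable ⊆ M.badLocus := Set.inter_subset_left

/-- Membership in the non-killable locus. -/
theorem mem_nonKillable_iff (M : GModel p q G ρ g₀) (v : M.V) : v ∈ M.nonKillable ↔ v ∈ M.badLocus ∧ ¬ M.KillableAt v := Iff.rfl

/-- **(A1) The non-killable locus is closed.** [OURS · L1 W4.5c] -/
theorem isClosed_nonKillable (M : GModel p q G ρ g₀) : IsClosed M.nonKillable :=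
  M.isClosed_badLocus.inter (by simpa only [← isOpen_compl_iff, Set.compl_setOf, not_not, compl_compl] using M.isOpen_setOf_killableAt)

/-- **Killability is `G`-invariant** (the witnessing charts are `G`-stable). [OURS · L1 W4.5c] -/
theorem killableAt_aut_base_iff (M : GModel p q G ρ g₀) (g : G) (v : M.V) :
    M.KillableAt ((M.act.aut g).hom.base v) ↔ M.KillableAt v := by
  constructor
  · rintro ⟨𝒦, d, O, hd, hv, hO⟩
    have hv' : v ∈ (M.act.aut g).hom ⁻¹ᵁ O.1 := hv
    rw [O.2.1 g] at hv'
    exact ⟨𝒦, d, O, hd, hv', hO⟩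
  · rintro ⟨𝒦, d, O, hd, hv, hO⟩
    have hv' : v ∈ (M.act.aut g).hom ⁻¹ᵁ O.1 := by rw [O.2.1 g]; exact hv
    exact ⟨𝒦, d, O, hd, hv', hO⟩

/-- **(A1) The non-killable locus is `G`-stable.** [OURS · L1 W4.5c] -/
theorem aut_base_mem_nonKillable_iff (M : GModel p q G ρ g₀) (g : G) (v : M.V) :
    (M.act.aut g).hom.base v ∈ M.nonKillable ↔ v ∈ M.nonKillable := by
  simp only [mem_nonKillable_iff, aut_base_mem_badLocus_iff, killableAt_aut_base_iff]

/-- (A1, set form) the preimage of the non-killable locus under each `g` is itself. -/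
theorem preimage_nonKillable (M : GModel p q G ρ g₀) (g : G) :
    (fun v => (M.act.aut g).hom.base v) ⁻¹' M.nonKillable = M.nonKillable :=
  Set.ext fun v => M.aut_base_mem_nonKillable_iff g v

/-- **`jInf = ⊥` iff the non-killable locus is empty.** [OURS · L1 W4.5c] -/
theorem jInf_eq_bot_iff (M : GModel p q G ρ g₀) : M.jInf = ⊥ ↔ M.nonKillable = ∅ := by
  rw [jInf, topologicalKrullDim, Order.krullDim_eq_bot_iff]
  constructor
  · intro h
    rw [Set.eq_empty_iff_forall_notMem]
    intro v hv
    exact h.elim ⟨closure {(⟨v, hv⟩ : M.nonKillable)}, isIrreducible_singleton.closure, isClosed_closure⟩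
  · intro h
    refine ⟨fun s => ?_⟩
    obtain ⟨⟨v, hv⟩, -⟩ := s.isIrreducible'.nonempty
    rw [h] at hv
    exact hv

/-- **The hypothesis of (K) in usable form**: if `jInf M = ⊥`, every bad point is killable. [OURS · L1 W4.5c] -/
theorem killableAt_of_jInf_eq_bot (M : GModel p q G ρ g₀) (h : M.jInf = ⊥) {v : M.V} (hv : v ∈ M.badLocus) : M.KillableAt v := by
  by_contra hk
  have : v ∈ M.nonKillable := ⟨hv, hk⟩
  rw [M.jInf_eq_bot_iff.mp h] at this
  exact this

/-- Conversely, if every bad point is killable then `jInf M = ⊥`. -/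
theorem jInf_eq_bot_of_forall_killableAt (M : GModel p q G ρ g₀) (h : ∀ v ∈ M.badLocus, M.KillableAt v) : M.jInf = ⊥ := by
  rw [jInf_eq_bot_iff, Set.eq_empty_iff_forall_notMem]
  exact fun v hv => hv.2 (h v hv.1)

/-- **The hypothesis of (A) in usable form**: `jInf M ≠ ⊥` iff some bad point is not killable. [OURS · L1 W4.5c] -/
theorem jInf_ne_bot_iff (M : GModel p q G ρ g₀) : M.jInf ≠ ⊥ ↔ ∃ v ∈ M.badLocus, ¬ M.KillableAt v := by
  rw [Ne, jInf_eq_bot_iff, ← Set.not_nonempty_iff_eq_empty, not_not]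
  exact ⟨fun ⟨v, hv⟩ => ⟨v, hv.1, hv.2⟩, fun ⟨v, hv, hk⟩ => ⟨v, hv, hk⟩⟩

/-- A terminal model has `jInf = ⊥`. -/
theorem jInf_eq_bot_of_terminal (M : GModel p q G ρ g₀) (h : M.Terminal) : M.jInf = ⊥ :=
  M.jInf_eq_bot_of_forall_killableAt fun v hv => absurd hv (by rw [(M.terminal_iff_badLocus_eq_empty).mp h]; exact id)

/-- `jInf` is bounded by the dimension of the model. -/
theorem jInf_le (M : GModel p q G ρ g₀) : M.jInf ≤ topologicalKrullDim M.V :=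
  topologicalKrullDim_subspace_le M.V M.nonKillable

/-- The non-killable locus of a quasi-compact model is a Noetherian space. -/
theorem noetherianSpace_nonKillable (M : GModel p q G ρ g₀) [CompactSpace M.V] : NoetherianSpace M.nonKillable := by
  haveI := M.isLocallyNoetherian
  haveI : IsNoetherian M.V := {}
  exact Topology.IsInducing.subtypeVal.noetherianSpace

/-- (A1) On a quasi-compact model the non-killable locus has finitely many irreducible components. -/
theorem finite_irreducibleComponents_nonKillable (M : GModel p q G ρ g₀) [CompactSpace M.V] :
    (irreducibleComponents M.nonKillable).Finite := by
  haveI := M.noetherianSpace_nonKillable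
  exact NoetherianSpace.finite_irreducibleComponents

end GameFrame.GModel

end Summit.ResolutionOfSingularities.ResolutionOfSingularities.Theorems.WildQuotientResolution.S1

end
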